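import Summits.QuantumFields.QCD.Theorems.HeatSlicedQuarksQuarkLoopCoefficientGaussianMajorantAux

/-!
# The `t⁻²`-Gaussian majorant of the symmetric-gauge heat symbol (stub `stub_gaussianMajorant`)
(line `Sketch` of crux stmt-QuantumFields-16786, `Summit.QuantumFields.QCD.Theses.HeatSlicedQuarks.QuarkLoopCoefficient`;
lead prover)

For `|θ| ≤ c₀`, `|θ| t ≤ c₀` the symmetric-gauge heat symbol `E_θ(t) = symHeat θ t` on `ℤ⁴` obeys
`‖E_θ(t)(w)_{αβ}‖ ≤ C (1+t)⁻² exp(−c|w|²/(1+t+|w|)) = C Γ_c(t,w)`.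

Proof (Peierls-dressed free parametrix + smallness bootstrap, no Grönwall lemma needed):
* the zeroth-order remainder `R₀ = E_θ − E₀` (`E₀(s) = k_s•1 = pert0 s`) solves `∂_s R₀ = −V_θ R₀ − q₀` with the forcing
  `q₀ = V_θ E₀ − vtx0 E₀ = (V_θ E₀ − vtx0 E₀ − θ vtx1 E₀) + θ vtx1 E₀`; the cocycle Taylor remainder gives
  `θ²(1+s)Γ` for the first bracket and the FIRST MOYAL CANCELLATION (`vtx_one_pert0`: the `v∧w` part of the
  first-order vertex drops out on the scalar free symbol) gives `|θ|Γ` — not `|θ|√(1+s)Γ` — for the second, so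
  `‖q₀(s)‖ ≤ K(θ²(1+s) + |θ|)Γ`;
* the registered twisted Duhamel principle (`stub_twistedDuhamel`) represents `R₀(u) = −∫₀ᵘ E_θ(u−s) ⋆_θ q₀(s) ds`;
* IMPROVEMENT: if `‖E_θ(u)(y)‖ ≤ M Γ(u,y)` for all `u ≤ t` then, by the mixed-convolution estimate (toolkit (2)) and
  `u(θ²(1+t) + |θ|) ≤ 3c₀`, `‖E_θ(u)(w)‖ ≤ (C_k + 12 K B c₀ · M) Γ(u,w) ≤ (C_k + M/2) Γ(u,w)` once `24 K B c₀ ≤ 1`;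
* the a-priori locality bound (`stub_heatLocality`) starts the iteration at a finite (huge, `t`-dependent) `M₀`, and
  `n` improvement steps give `2C_k + M₀/2ⁿ ≤ 3 C_k` for `n` large (depending on `t`, which is harmless).
-/

noncomputable section

namespace Summit.QuantumFields.QCD.Cruxes.QuarkLoopCoefficient.Sketch

open Literature.MathematicalPhysics.QuantumLattice Literature.MathematicalPhysics.QuantumFieldTheory
open Literature.Probability.LatticeModels (Site)
open Summit.QuantumFields.QCD.Theorems.QuarkLoopCoefficient
open Summit.QuantumFields.QCD.Cruxes.QuarkLoopCoefficient.Sketch.HeatSeries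
open Summit.QuantumFields.QCD.Cruxes.QuarkLoopCoefficient.Sketch.FreeMajorantToolkit
open Summit.QuantumFields.QCD.Cruxes.QuarkLoopCoefficient.Sketch.SymmetricGauge
open Summit.QuantumFields.QCD.Cruxes.QuarkLoopCoefficient.Sketch.SecondOrderExpansion
open scoped Matrix ComplexConjugate

attribute [local irreducible] nbr nbr2

namespace GaussianMajorant

/-! ## §4 The improvement step of the bootstrap -/

/-- `u (θ²(1+t) + |θ|) ≤ 3 c₀` for `0 ≤ u ≤ t`, `|θ| ≤ c₀ ≤ 1`, `|θ| t ≤ c₀`. -/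
theorem time_weight_le {θ t u c₀ : ℝ} (hu : u ∈ Set.Icc 0 t) (hθ : |θ| ≤ c₀) (hθt : |θ| * t ≤ c₀)
    (hc₀1 : c₀ ≤ 1) : u * (θ ^ 2 * (1 + t) + |θ|) ≤ 3 * c₀ := by
  have ha := abs_nonneg θ
  have hc₀ : 0 ≤ c₀ := ha.trans hθ
  have hut : u * |θ| ≤ c₀ := by nlinarith [hu.1, hu.2]
  have hu0 := hu.1
  have e : u * (θ ^ 2 * (1 + t) + |θ|) = (u * |θ|) * |θ| + (u * |θ|) * (|θ| * t) + u * |θ| := by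
    rw [← sq_abs θ]; ring
  rw [e]
  have h1 : (u * |θ|) * |θ| ≤ c₀ * c₀ := mul_le_mul hut hθ ha hc₀
  have h2 : (u * |θ|) * (|θ| * t) ≤ c₀ * c₀ :=
    mul_le_mul hut hθt (by nlinarith [hu.1, hu.2]) hc₀
  nlinarith

/-- **Improvement step.**  If `‖E_θ(u)(y)_{αγ}‖ ≤ M Γ_{c_k/8}(u,y)` for all `u ∈ [0,t]`, then
`‖E_θ(u)(w)_{αβ}‖ ≤ (C_k + M/2) Γ_{c_k/8}(u,w)` for all `u ∈ [0,t]`, provided `24 K B c₀ ≤ 1`. -/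
theorem improve {Ck ck K Bm c₀ : ℝ} (hck : 0 < ck) (hK : 0 ≤ K) (hBm0 : 0 ≤ Bm) (hc₀1 : c₀ ≤ 1)
    (hsmall : 12 * K * Bm * c₀ ≤ 1 / 2)
    (hk : ∀ t : ℝ, 0 ≤ t → ∀ w : Site 4, |freeKer t w| ≤ Ck * gaussProfile ck t w)
    (hT3 : ∀ c ε : ℝ, 0 < c → 0 < ε → ε < 1 → ∀ j : ℕ, ∃ A : ℝ, ∀ t : ℝ, 0 ≤ t → ∀ w : Site 4,
      elen w ^ j * gaussProfile c t w ≤ A * Real.sqrt (1 + t) ^ j * gaussProfile ((1 - ε) * c) t w)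
    (hT4 : ∀ c ε : ℝ, 0 < c → 0 < ε → ε < 1 → ∃ A : ℝ, ∀ t : ℝ, 0 ≤ t → ∀ w z : Site 4, elen z ≤ 2 →
      gaussProfile c t (w + z) ≤ A * gaussProfile ((1 - ε) * c) t w)
    (h1 : ∀ x y : Site 4, sqKer (fun _ => (1 : ℂ)) x y = ((hhat (y - x) : ℝ) : ℂ) • (1 : Spin))
    (h3 : ∀ w : Site 4, freeKer 0 w = if w = 0 then 1 else 0)
    (h4 : ∀ (t : ℝ) (w : Site 4),
      HasDerivAt (fun s => freeKer s w) (-(∑ z ∈ nbr2 0, hhat z * freeKer t (w - z))) t)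
    (h6 : ∀ t : ℝ, 0 ≤ t → ∀ (w : Site 4) (ν : Fin 4),
      t * (∑ z ∈ nbr2 0, ((z ν : ℤ) : ℝ) * hhat z * freeKer t (w - z)) + ((w ν : ℤ) : ℝ) * freeKer t w = 0)
    (hBm : ∀ a b : ℝ, 0 ≤ a → 0 ≤ b → ∀ w : Site 4,
      Summable (fun y : Site 4 => gaussProfile ((1 - 1 / 2) * (ck / 4)) a y * gaussProfile (ck / 4) b (w - y)) ∧
      ∑' y : Site 4, gaussProfile ((1 - 1 / 2) * (ck / 4)) a y * gaussProfile (ck / 4) b (w - y) ≤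
        Bm * gaussProfile ((1 - 1 / 2) * (ck / 4)) (a + b) w)
    (hq : ∀ θ : ℝ, ∀ s : ℝ, 0 ≤ s → ∀ (w : Site 4) (γ δ : Fin 4),
      ‖(((∑ v ∈ nbr2 0, Complex.exp (((θ / 2 * (wedge v w : ℤ) : ℝ) : ℂ) * Complex.I) • (sqKer (symLink θ) 0 v * pert0 s (w - v))) - vtx 0 (pert0 s) w)) γ δ‖ ≤ K * (θ ^ 2 * (1 + s) + |θ|) * gaussProfile (ck / 4) s w)
    (θ t : ℝ) (hθ : |θ| ≤ c₀) (hθt : |θ| * t ≤ c₀) {M : ℝ} (hM : 0 ≤ M)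
    (hE : ∀ u ∈ Set.Icc 0 t, ∀ (y : Site 4) (α γ : Fin 4),
      ‖symHeat θ u y α γ‖ ≤ M * gaussProfile (ck / 8) u y) :
    ∀ u ∈ Set.Icc 0 t, ∀ (w : Site 4) (α β : Fin 4),
      ‖symHeat θ u w α β‖ ≤ (Ck + M / 2) * gaussProfile (ck / 8) u w := by
  intro u hu w α β
  have hCk : 0 ≤ Ck := zero_le_one.trans (one_le_Ck hk h3)
  have hΓ8 := gaussProfile_nonneg (ck / 8) u w
  have hP : ‖pert0 u w α β‖ ≤ Ck * gaussProfile (ck / 8) u w :=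
    (norm_pert0_apply_le hk hu.1 w α β).trans
      (mul_le_mul_of_nonneg_left (gaussProfile_anti (by linarith) hu.1 w) hCk)
  have hsplit : symHeat θ u w α β = pert0 u w α β + (symHeat θ u w - pert0 u w) α β := by
    simp [Matrix.sub_apply]
  rw [hsplit]
  refine (norm_add_le _ _).trans ?_
  suffices hR : ‖(symHeat θ u w - pert0 u w) α β‖ ≤ M / 2 * gaussProfile (ck / 8) u w by linarith
  rcases hu.1.eq_or_lt with h0 | hupos
  · rw [← h0, remainder₀_zero h3 θ w, Matrix.zero_apply, norm_zero]
    rw [← h0] at hΓ8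
    exact mul_nonneg (by positivity) hΓ8
  rw [remainder₀_eq_integral hck hk hT3 hT4 h1 h3 h4 h6 θ hupos w α β, norm_neg]
  have hpt : ∀ s ∈ Set.Ioc 0 u, ‖(∑' y : Site 4,
      Complex.exp (((θ / 2 * (wedge y w : ℤ) : ℝ) : ℂ) * Complex.I) •
        (symHeat θ (u - s) y * ((∑ v ∈ nbr2 0, Complex.exp (((θ / 2 * (wedge v (w - y) : ℤ) : ℝ) : ℂ) * Complex.I) • (sqKer (symLink θ) 0 v * pert0 s ((w - y) - v))) - vtx 0 (pert0 s) (w - y)))) α β‖ ≤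
      4 * M * (K * (θ ^ 2 * (1 + t) + |θ|)) * Bm * gaussProfile (ck / 8) u w := by
    intro s hs
    have hs0 : 0 ≤ s := hs.1.le
    have hus : 0 ≤ u - s := by linarith [hs.2]
    have e8 : ck / 4 / 2 = ck / 8 := by ring
    have hE' : ∀ (y : Site 4) (α γ : Fin 4), ‖symHeat θ (u - s) y α γ‖ ≤ M * gaussProfile (ck / 4 / 2) (u - s) y := by
      intro y α γ
      rw [e8]
      exact hE (u - s) ⟨hus, by linarith [hu.2, hs.1]⟩ y α γ
    have hQ : ∀ (y : Site 4) (γ β : Fin 4), ‖(((∑ v ∈ nbr2 0, Complex.exp (((θ / 2 * (wedge v y : ℤ) : ℝ) : ℂ) * Complex.I) • (sqKer (symLink θ) 0 v * pert0 s (y - v))) - vtx 0 (pert0 s) y)) γ β‖ ≤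
        K * (θ ^ 2 * (1 + t) + |θ|) * gaussProfile (ck / 4) s y := by
      intro y γ β
      refine (hq θ s hs0 y γ β).trans ?_
      have hΓ := gaussProfile_nonneg (ck / 4) s y
      have hst : θ ^ 2 * (1 + s) + |θ| ≤ θ ^ 2 * (1 + t) + |θ| := by
        have : s ≤ t := hs.2.trans hu.2
        nlinarith [sq_nonneg θ]
      exact mul_le_mul_of_nonneg_right (mul_le_mul_of_nonneg_left hst hK) hΓ
    have hb0 : 0 ≤ K * (θ ^ 2 * (1 + t) + |θ|) := by
      have : 0 ≤ 1 + t := by linarith [hu.1, hu.2]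
      positivity
    have key := (twistedConv_summable_and_norm_le hBm θ hM hb0 hus hs0 hE' hQ w).2 α β
    rw [sub_add_cancel, e8] at key
    exact key
  have hu3 := time_weight_le hu hθ hθt hc₀1
  calc ‖∫ s in (0 : ℝ)..u, (∑' y : Site 4,
        Complex.exp (((θ / 2 * (wedge y w : ℤ) : ℝ) : ℂ) * Complex.I) •
          (symHeat θ (u - s) y * ((∑ v ∈ nbr2 0, Complex.exp (((θ / 2 * (wedge v (w - y) : ℤ) : ℝ) : ℂ) * Complex.I) • (sqKer (symLink θ) 0 v * pert0 s ((w - y) - v))) - vtx 0 (pert0 s) (w - y)))) α β‖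
      ≤ 4 * M * (K * (θ ^ 2 * (1 + t) + |θ|)) * Bm * gaussProfile (ck / 8) u w * |u - 0| :=
        intervalIntegral.norm_integral_le_of_norm_le_const fun s hs => hpt s (by rwa [Set.uIoc_of_le hu.1] at hs)
    _ = M * (4 * K * Bm) * (u * (θ ^ 2 * (1 + t) + |θ|)) * gaussProfile (ck / 8) u w := by
        rw [sub_zero, abs_of_nonneg hu.1]; ring
    _ ≤ M * (4 * K * Bm) * (3 * c₀) * gaussProfile (ck / 8) u w := by
        have : 0 ≤ M * (4 * K * Bm) := by positivity
        gcongr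
    _ = M * (12 * K * Bm * c₀) * gaussProfile (ck / 8) u w := by ring
    _ ≤ M * (1 / 2) * gaussProfile (ck / 8) u w := by gcongr
    _ = M / 2 * gaussProfile (ck / 8) u w := by ring

/-! ## §5 The a-priori (locality) bound that starts the bootstrap -/

/-- `|w|₂ ≤ |w|₁` on `ℤ⁴`. -/
theorem elen_le_l1 (w : Site 4) : elen w ≤ ∑ μ : Fin 4, |((w μ : ℤ) : ℝ)| := by
  unfold elen
  have hnn : 0 ≤ ∑ μ : Fin 4, |((w μ : ℤ) : ℝ)| := Finset.sum_nonneg fun μ _ => abs_nonneg _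
  have hsq : ∑ μ : Fin 4, ((w μ : ℤ) : ℝ) ^ 2 ≤ (∑ μ : Fin 4, |((w μ : ℤ) : ℝ)|) ^ 2 := by
    simp only [Fin.sum_univ_four]
    rw [← sq_abs ((w 0 : ℤ) : ℝ), ← sq_abs ((w 1 : ℤ) : ℝ), ← sq_abs ((w 2 : ℤ) : ℝ), ← sq_abs ((w 3 : ℤ) : ℝ)]
    have h0 := abs_nonneg ((w 0 : ℤ) : ℝ)
    have h1 := abs_nonneg ((w 1 : ℤ) : ℝ)
    have h2 := abs_nonneg ((w 2 : ℤ) : ℝ)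
    have h3 := abs_nonneg ((w 3 : ℤ) : ℝ)
    nlinarith [mul_nonneg h0 h1, mul_nonneg h0 h2, mul_nonneg h0 h3, mul_nonneg h1 h2, mul_nonneg h1 h3,
      mul_nonneg h2 h3]
  calc Real.sqrt (∑ μ : Fin 4, ((w μ : ℤ) : ℝ) ^ 2) ≤ Real.sqrt ((∑ μ : Fin 4, |((w μ : ℤ) : ℝ)|) ^ 2) :=
        Real.sqrt_le_sqrt hsq
    _ = ∑ μ : Fin 4, |((w μ : ℤ) : ℝ)| := Real.sqrt_sq hnn

/-- **A-priori weighted bound**: for `0 ≤ c`, all `u ∈ [0,t]`: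
`‖E_θ(u)(y)_{αγ}‖ ≤ (1+t)² exp(e^{2c} R t) · Γ_c(u,y)` (finite propagation speed of the exponential series). -/
theorem apriori (θ t : ℝ) {c : ℝ} (hc : 0 ≤ c) :
    ∀ u ∈ Set.Icc 0 t, ∀ (y : Site 4) (α γ : Fin 4),
      ‖symHeat θ u y α γ‖ ≤ ((1 + t) ^ 2 * Real.exp (Real.exp (2 * c) * 1679616 * t)) * gaussProfile c u y := by
  intro u hu y α γ
  have h := HeatLocality.norm_heatKer_apply_le_exp (norm_symLink_le θ) hc u 0 y α γ
  simp only [Pi.zero_apply, sub_zero, abs_of_nonneg hu.1] at h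
  change ‖heatKer (symLink θ) u 0 y α γ‖ ≤ _
  refine h.trans ?_
  have he := elen_nonneg y
  have hl1 : elen y ≤ ∑ μ : Fin 4, |((y μ : ℤ) : ℝ)| := elen_le_l1 y
  have hprof : Real.exp (-(c * ∑ μ : Fin 4, |((y μ : ℤ) : ℝ)|)) ≤ (1 + t) ^ 2 * gaussProfile c u y := by
    unfold gaussProfile
    have hfrac : c * elen y ^ 2 / (1 + u + elen y) ≤ c * ∑ μ : Fin 4, |((y μ : ℤ) : ℝ)| := by
      have hq : elen y ^ 2 / (1 + u + elen y) ≤ elen y := by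
        rw [div_le_iff₀ (by linarith [hu.1])]
        nlinarith [hu.1]
      calc c * elen y ^ 2 / (1 + u + elen y) = c * (elen y ^ 2 / (1 + u + elen y)) := by ring
        _ ≤ c * elen y := mul_le_mul_of_nonneg_left hq hc
        _ ≤ c * ∑ μ : Fin 4, |((y μ : ℤ) : ℝ)| := mul_le_mul_of_nonneg_left hl1 hc
    have hexp : Real.exp (-(c * ∑ μ : Fin 4, |((y μ : ℤ) : ℝ)|)) ≤
        Real.exp (-(c * elen y ^ 2 / (1 + u + elen y))) := Real.exp_le_exp.mpr (by linarith)
    have hone : (1 : ℝ) ≤ (1 + t) ^ 2 * ((1 + u) ^ 2)⁻¹ := by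
      rw [← div_eq_mul_inv, le_div_iff₀ (by nlinarith [hu.1])]
      nlinarith [hu.1, hu.2]
    calc Real.exp (-(c * ∑ μ : Fin 4, |((y μ : ℤ) : ℝ)|))
        ≤ Real.exp (-(c * elen y ^ 2 / (1 + u + elen y))) := hexp
      _ = 1 * Real.exp (-(c * elen y ^ 2 / (1 + u + elen y))) := (one_mul _).symm
      _ ≤ ((1 + t) ^ 2 * ((1 + u) ^ 2)⁻¹) * Real.exp (-(c * elen y ^ 2 / (1 + u + elen y))) :=
          mul_le_mul_of_nonneg_right hone (Real.exp_pos _).le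
      _ = (1 + t) ^ 2 * (((1 + u) ^ 2)⁻¹ * Real.exp (-(c * elen y ^ 2 / (1 + u + elen y)))) := by ring
  have hΓ := gaussProfile_nonneg c u y
  have ht2 : Real.exp (Real.exp (2 * c) * 1679616 * u) ≤ Real.exp (Real.exp (2 * c) * 1679616 * t) := by
    rw [Real.exp_le_exp]
    have := Real.exp_pos (2 * c)
    nlinarith [hu.2]
  calc Real.exp (-(c * ∑ μ : Fin 4, |((y μ : ℤ) : ℝ)|)) * Real.exp (Real.exp (2 * c) * 1679616 * u)
      ≤ ((1 + t) ^ 2 * gaussProfile c u y) * Real.exp (Real.exp (2 * c) * 1679616 * t) :=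
        mul_le_mul hprof ht2 (Real.exp_pos _).le (by positivity)
    _ = _ := by ring

end GaussianMajorant


/-! ## §6 The registered stub -/

open GaussianMajorant in
/-- **Stub `stub_gaussianMajorant`** (registered, LEAD): the `t⁻²`-Gaussian majorant of the symmetric-gauge heat
symbol, `FreeMajorantToolkit → FreeHeatCalculus → GaussianMajorant` (expanded): there are `c₀ > 0`, `C`, `c > 0`
with `‖symHeat θ t w α β‖ ≤ C Γ_c(t,w)` whenever `0 ≤ t`, `|θ| ≤ c₀`, `|θ| t ≤ c₀`.  Constants: `c = c_k/8`,
`C = 3 C_k`, `c₀ = 1/(24 K B + 1)` (`K` the forcing constant, `B` the mixed-convolution constant at `c_k/4`). -/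
theorem stub_gaussianMajorant :
    ((∃ C c : ℝ, 0 < c ∧ ∀ t : ℝ, 0 ≤ t → ∀ w : Site 4, |freeKer t w| ≤ C * gaussProfile c t w) ∧
      (∀ c ε : ℝ, 0 < c → 0 < ε → ε < 1 → ∃ B : ℝ, ∀ a b : ℝ, 0 ≤ a → 0 ≤ b → ∀ w : Site 4,
        Summable (fun y : Site 4 => gaussProfile ((1 - ε) * c) a y * gaussProfile c b (w - y)) ∧
        ∑' y : Site 4, gaussProfile ((1 - ε) * c) a y * gaussProfile c b (w - y) ≤
          B * gaussProfile ((1 - ε) * c) (a + b) w) ∧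
      (∀ c ε : ℝ, 0 < c → 0 < ε → ε < 1 → ∀ j : ℕ, ∃ A : ℝ, ∀ t : ℝ, 0 ≤ t → ∀ w : Site 4,
        elen w ^ j * gaussProfile c t w ≤ A * Real.sqrt (1 + t) ^ j * gaussProfile ((1 - ε) * c) t w) ∧
      (∀ c ε : ℝ, 0 < c → 0 < ε → ε < 1 → ∃ A : ℝ, ∀ t : ℝ, 0 ≤ t → ∀ w z : Site 4, elen z ≤ 2 →
        gaussProfile c t (w + z) ≤ A * gaussProfile ((1 - ε) * c) t w) ∧
      (∀ c : ℝ, 0 < c → ∃ A : ℝ, ∀ t : ℝ, 0 ≤ t →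
        Summable (fun y : Site 4 => gaussProfile c t y) ∧ ∑' y : Site 4, gaussProfile c t y ≤ A) ∧
      (∀ c : ℝ, 0 < c → ∃ C : ℝ, ∀ (L : ℕ), 1 ≤ L → ∀ t : ℝ, 1 ≤ t → t ≤ (L : ℝ) ^ 2 →
        Summable (fun n : Site 4 => gaussProfile c t (fun μ => (L : ℤ) * n μ)) ∧
        ∑' n : Site 4, (if n = 0 then 0 else gaussProfile c t (fun μ => (L : ℤ) * n μ)) ≤
          C * Real.exp (-(c / 2 * (L : ℝ) ^ 2 / (t + (L : ℝ)))) / t ^ 2)) →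
    ((∀ x y : Site 4, sqKer (fun _ => (1 : ℂ)) x y = ((hhat (y - x) : ℝ) : ℂ) • (1 : Spin)) ∧
      (∀ t : ℝ, 0 ≤ t → ∀ x y : Site 4,
        heatKer (fun _ => (1 : ℂ)) t x y = ((freeKer t (y - x) : ℝ) : ℂ) • (1 : Spin)) ∧
      (∀ w : Site 4, freeKer 0 w = if w = 0 then 1 else 0) ∧
      (∀ (t : ℝ) (w : Site 4),
        HasDerivAt (fun s => freeKer s w) (-(∑ z ∈ nbr2 0, hhat z * freeKer t (w - z))) t) ∧
      (∀ s r : ℝ, 0 ≤ s → 0 ≤ r → ∀ w : Site 4,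
        HasSum (fun y : Site 4 => freeKer s y * freeKer r (w - y)) (freeKer (s + r) w)) ∧
      (∀ t : ℝ, 0 ≤ t → ∀ (w : Site 4) (ν : Fin 4),
        t * (∑ z ∈ nbr2 0, ((z ν : ℤ) : ℝ) * hhat z * freeKer t (w - z)) + ((w ν : ℤ) : ℝ) * freeKer t w = 0) ∧
      (∀ (t : ℝ) (w : Site 4), freeKer t (-w) = freeKer t w)) →
    (∃ c₀ : ℝ, 0 < c₀ ∧ ∃ C c : ℝ, 0 < c ∧ ∀ θ t : ℝ, 0 ≤ t → |θ| ≤ c₀ → |θ| * t ≤ c₀ →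
        ∀ (w : Site 4) (α β : Fin 4), ‖symHeat θ t w α β‖ ≤ C * gaussProfile c t w) := by
  rintro ⟨⟨Ck, ck, hck, hk⟩, hT2, hT3, hT4, -, -⟩ ⟨h1, -, h3, h4, -, h6, -⟩
  have hCk1 : 1 ≤ Ck := one_le_Ck hk h3
  have hCk : 0 ≤ Ck := zero_le_one.trans hCk1
  obtain ⟨K, hK0, hq⟩ := exists_forcing₀_bound hck hk hT3 hT4 h1 h3 h6
  obtain ⟨Bm, hBm⟩ := hT2 (ck / 4) (1 / 2) (by positivity) (by norm_num) (by norm_num)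
  -- a nonnegative mixed-convolution constant
  have hBm' : ∀ a b : ℝ, 0 ≤ a → 0 ≤ b → ∀ w : Site 4,
      Summable (fun y : Site 4 => gaussProfile ((1 - 1 / 2) * (ck / 4)) a y * gaussProfile (ck / 4) b (w - y)) ∧
      ∑' y : Site 4, gaussProfile ((1 - 1 / 2) * (ck / 4)) a y * gaussProfile (ck / 4) b (w - y) ≤
        max Bm 0 * gaussProfile ((1 - 1 / 2) * (ck / 4)) (a + b) w :=
    fun a b ha hb w => ⟨(hBm a b ha hb w).1, (hBm a b ha hb w).2.trans
      (mul_le_mul_of_nonneg_right (le_max_left _ _) (gaussProfile_nonneg _ _ _))⟩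
  have hB0 : 0 ≤ max Bm 0 := le_max_right _ _
  -- the smallness constant
  set c₀ : ℝ := 1 / (24 * K * max Bm 0 + 1) with hc₀def
  have hden : 0 < 24 * K * max Bm 0 + 1 := by positivity
  have hc₀ : 0 < c₀ := by rw [hc₀def]; positivity
  have hc₀1 : c₀ ≤ 1 := by
    rw [hc₀def, div_le_one hden]
    nlinarith [mul_nonneg hK0 hB0]
  have hsmall : 12 * K * max Bm 0 * c₀ ≤ 1 / 2 := by
    rw [hc₀def, ← mul_div_assoc, mul_one, div_le_iff₀ hden]
    nlinarith [mul_nonneg hK0 hB0]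
  refine ⟨c₀, hc₀, 3 * Ck, ck / 8, by positivity, fun θ t ht hθ hθt w α β => ?_⟩
  -- the improvement map and its iteration from the a-priori bound
  have himp : ∀ M : ℝ, 0 ≤ M →
      (∀ u ∈ Set.Icc 0 t, ∀ (y : Site 4) (α γ : Fin 4), ‖symHeat θ u y α γ‖ ≤ M * gaussProfile (ck / 8) u y) →
      ∀ u ∈ Set.Icc 0 t, ∀ (y : Site 4) (α γ : Fin 4),
        ‖symHeat θ u y α γ‖ ≤ (Ck + M / 2) * gaussProfile (ck / 8) u y :=
    fun M hM hE => improve hck hK0 hB0 hc₀1 hsmall hk hT3 hT4 h1 h3 h4 h6 hBm' hq θ t hθ hθt hM hE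
  set M₀ : ℝ := (1 + t) ^ 2 * Real.exp (Real.exp (2 * (ck / 8)) * 1679616 * t) with hM₀
  have hM₀0 : 0 ≤ M₀ := by rw [hM₀]; positivity
  have hP : ∀ n : ℕ, ∀ u ∈ Set.Icc 0 t, ∀ (y : Site 4) (α γ : Fin 4),
      ‖symHeat θ u y α γ‖ ≤ (2 * Ck + M₀ / 2 ^ n) * gaussProfile (ck / 8) u y := by
    intro n
    induction n with
    | zero =>
      intro u hu y α γ
      have h0 := apriori θ t (c := ck / 8) (by positivity) u hu y α γ
      refine h0.trans (mul_le_mul_of_nonneg_right ?_ (gaussProfile_nonneg _ _ _))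
      rw [pow_zero, div_one]
      linarith
    | succ n ih =>
      have hMn : 0 ≤ 2 * Ck + M₀ / 2 ^ n := by positivity
      have h := himp _ hMn ih
      have e : Ck + (2 * Ck + M₀ / 2 ^ n) / 2 = 2 * Ck + M₀ / 2 ^ (n + 1) := by
        rw [pow_succ]; ring
      rw [e] at h
      exact h
  -- choose `n` with `M₀ / 2ⁿ ≤ C_k`
  obtain ⟨n, hn⟩ := pow_unbounded_of_one_lt (M₀ / Ck) (by norm_num : (1 : ℝ) < 2)
  have hCkpos : 0 < Ck := by linarith
  have hn' : M₀ / 2 ^ n ≤ Ck := by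
    rw [div_lt_iff₀ hCkpos] at hn
    rw [div_le_iff₀ (by positivity)]
    linarith
  have hΓ := gaussProfile_nonneg (ck / 8) t w
  calc ‖symHeat θ t w α β‖ ≤ (2 * Ck + M₀ / 2 ^ n) * gaussProfile (ck / 8) t w := hP n t ⟨ht, le_rfl⟩ w α β
    _ ≤ 3 * Ck * gaussProfile (ck / 8) t w := by
        refine mul_le_mul_of_nonneg_right ?_ hΓ
        linarith

end Summit.QuantumFields.QCD.Cruxes.QuarkLoopCoefficient.Sketch

end
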